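import Mathlib
import Summits.CriticalPhenomena.CardyFormulaZ2.Theorems.CardyMagicRigidityNestingRigidityUVTiltTransferInputs
import HarnessLib

/-!
# Crux `NestingRigidity`, line `ring-cloud-tomography` (r5): hypothesis (L) of
# `uvDecoupling_of_tilted_moments` REDUCED to collar first moments (tilt transfer, step 3)

Crux `Summit.CriticalPhenomena.CardyFormulaZ2.Theses.CardyMagicRigidity.NestingRigidity`
(stmt-CriticalPhenomena-4835), line `ring-cloud-tomography`, stub R1'
`stub_uvDecoupling : ∀ E ∈ latticeEnsembles, UVDecoupling E`.  The reduction
`uvDecoupling_of_tilted_moments` (…UVLinearisation) splits R1' into hypothesis (L) (one-sided tilted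
first moments of `Θ = Σ_{u ∉ tower} θ_u` and `Θ₂ = Σ θ_u²`) and hypothesis (U) (tilted exponential
moment).  This file closes the TILT TRANSFER of (L) on BOTH lattices modulo collar first moments
(registered anchor `lowerInput_of_collar_bounds`): (L) follows from
(HK) first moments of the COLLAR STATISTIC `K = Σ_{u ∈ C_r} φ_u + #X + Σ_{u ∈ C_1} ψ_u`
     (inner-collar crossings weighted by disc fractions, exit loops, outer-collar crossings weighted
     by ring fractions; `abs_uvPhaseBd_le_collar_latticeEnsembles`), UNTILTED `E_δ[K] ≤ C` and
     TILTED `E_δ[w^N K] ≤ C·E_δ[w^N]` (`w = magicWeight t`, `N = N_0(r,1)`), and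
(H2) the untilted UV tightness `E_δ[Θ₂] ≤ C`,
for all small `r` and then all small meshes.  Proof: the exact independence split
`E[w^N Θ] = E[w^N](E Θ − E Θ_B) + E[w^N Θ_B]` (…UVTiltTransfer, and its `Θ₂` twin), the EXACT
untilted identity `E Θ = −t·E N` on both lattices (`integral_uvPhase_latticeEnsembles`), and the
pathwise dominations `|Θ_B| ≤ |t| K`, `0 ≤ Θ₂,B ≤ t² K`.  Corollary `uvDecoupling_of_collar_bounds`:
`(HK) → (H2) → (U) → UVDecoupling E`.  What remains of R1' is thus RSW only: the untilted collar /
tightness first moments (keystones K1/K2 summed over dyadic scales), the TILTED collar bound (window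
change `E[w^{N_0(2r,1)}] ≤ C E[w^{N_0(r,1)}]` + independence), and (U).  No cited fact, no definition.
-/

noncomputable section

open MeasureTheory ProbabilityTheory Set Filter Metric
open scoped Real Topology BigOperators

namespace Summit.CriticalPhenomena.CardyFormulaZ2.Cruxes.NestingRigidity.RingCloudTomography

open Literature.Probability.RandomPlanarGeometry Literature.Probability.Percolation
  Literature.Probability.LatticeModels
open Summit.CriticalPhenomena.CardyFormulaZ2.Cruxes.NestingRigidity.PositiveConeWeightDoubling
  (magicWeight meanTower UVDecoupling coneCloud magicWeight_nonneg_of_mem_cone)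

/-- **Hypothesis (L) of `uvDecoupling_of_tilted_moments` from collar first moments** (registered
helper toward stub R1' `stub_uvDecoupling`, line `ring-cloud-tomography` r5; both lattices).  For
`E ∈ latticeEnsembles`: IF for every charge `t` in the cone, with `w = magicWeight t`,
`N = N_0(r,1)` and the collar statistic `K = Σ_{u ∈ C_r} φ_u + #X + Σ_{u ∈ C_1} ψ_u` of
`abs_uvPhaseBd_le_collar_latticeEnsembles`, for all small `r` and then all small meshes
(HK) `E_δ[K] ≤ C` and `E_δ[w^N K] ≤ C · E_δ[w^N]`, and (H2) `E_δ[Θ₂] ≤ C`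
(`Θ₂ = Σ_{u ∉ tower} θ_u²`), THEN hypothesis (L) holds verbatim: `w^N Θ`, `w^N Θ₂` are integrable,
`E_δ[w^N Θ] ≤ (C' − t·E_δ N)·E_δ[w^N]` and `E_δ[w^N Θ₂] ≤ C'·E_δ[w^N]`.  (Exact independence split,
exact untilted identity `E_δ Θ = −t E_δ N` on both lattices, `|Θ_B| ≤ |t| K`, `0 ≤ Θ₂,B ≤ t² K`.) -/
theorem lowerInput_of_collar_bounds : ∀ E ∈ latticeEnsembles,
    (∀ t ∈ Set.Ioo (-(π / 6)) (π / 6), ∃ C r₀ : ℝ, 0 < r₀ ∧ ∀ r ∈ Set.Ioo (0 : ℝ) r₀,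
      ∀ᶠ δ in 𝓝[>] (0 : ℝ),
        ∫ ω, ((∑ᶠ u ∈ {u ∈ (E.X δ ω).loops | (u.range ∩ Metric.closedBall (0 : ℂ) r).Nonempty ∧
              ¬ u.range ⊆ Metric.ball (0 : ℂ) (r - 2 * δ)},
              ∫ z in {z | u.wind z ≠ 0}, discDensity 0 r z) +
            ({u ∈ (E.X δ ω).loops | Metric.closedBall (0 : ℂ) r ⊆ {z | u.wind z ≠ 0} ∧
              ¬ u.range ⊆ Metric.ball (0 : ℂ) 1 ∧
              (u.range ∩ Metric.closedBall (0 : ℂ) (1 + 2 * δ)).Nonempty}.ncard : ℝ) +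
            ∑ᶠ u ∈ {u ∈ (E.X δ ω).loops |
              (u.range ∩ Metric.closedBall (0 : ℂ) (1 + 2 * δ)).Nonempty ∧
                ¬ u.range ⊆ Metric.ball (0 : ℂ) 1},
              ∫ z in {z | u.wind z ≠ 0}, annulusDensity 0 1 2 z) ∂E.P ≤ C ∧
        ∫ ω, magicWeight t ^ towerCount (E.X δ ω) 0 r 1 *
            ((∑ᶠ u ∈ {u ∈ (E.X δ ω).loops | (u.range ∩ Metric.closedBall (0 : ℂ) r).Nonempty ∧
                ¬ u.range ⊆ Metric.ball (0 : ℂ) (r - 2 * δ)},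
                ∫ z in {z | u.wind z ≠ 0}, discDensity 0 r z) +
              ({u ∈ (E.X δ ω).loops | Metric.closedBall (0 : ℂ) r ⊆ {z | u.wind z ≠ 0} ∧
                ¬ u.range ⊆ Metric.ball (0 : ℂ) 1 ∧
                (u.range ∩ Metric.closedBall (0 : ℂ) (1 + 2 * δ)).Nonempty}.ncard : ℝ) +
              ∑ᶠ u ∈ {u ∈ (E.X δ ω).loops |
                (u.range ∩ Metric.closedBall (0 : ℂ) (1 + 2 * δ)).Nonempty ∧
                  ¬ u.range ⊆ Metric.ball (0 : ℂ) 1},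
                ∫ z in {z | u.wind z ≠ 0}, annulusDensity 0 1 2 z) ∂E.P ≤
          C * E.towerMoment (magicWeight t) δ r) →
    (∀ t ∈ Set.Ioo (-(π / 6)) (π / 6), ∃ C r₀ : ℝ, 0 < r₀ ∧ ∀ r ∈ Set.Ioo (0 : ℝ) r₀,
      ∀ᶠ δ in 𝓝[>] (0 : ℝ),
        ∫ ω, ∑ᶠ u ∈ (E.X δ ω).loops \ {u ∈ (E.X δ ω).loops |
            Metric.closedBall (0 : ℂ) r ⊆ {z | u.wind z ≠ 0} ∧ u.range ⊆ Metric.ball (0 : ℂ) 1},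
            u.nestingPhase (coneCloud t r).density ^ 2 ∂E.P ≤ C) →
    (∀ t ∈ Set.Ioo (-(π / 6)) (π / 6), ∃ C r₀ : ℝ, 0 < r₀ ∧ ∀ r ∈ Set.Ioo (0 : ℝ) r₀,
      ∀ᶠ δ in 𝓝[>] (0 : ℝ), ∀ Θ Θ₂ : E.Ω → ℝ,
        (∀ ω, Θ ω = ∑ᶠ u ∈ (E.X δ ω).loops \ {u ∈ (E.X δ ω).loops |
            Metric.closedBall (0 : ℂ) r ⊆ {z | u.wind z ≠ 0} ∧ u.range ⊆ Metric.ball (0 : ℂ) 1},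
            u.nestingPhase (coneCloud t r).density) →
        (∀ ω, Θ₂ ω = ∑ᶠ u ∈ (E.X δ ω).loops \ {u ∈ (E.X δ ω).loops |
            Metric.closedBall (0 : ℂ) r ⊆ {z | u.wind z ≠ 0} ∧ u.range ⊆ Metric.ball (0 : ℂ) 1},
            u.nestingPhase (coneCloud t r).density ^ 2) →
        Integrable (fun ω ↦ magicWeight t ^ towerCount (E.X δ ω) 0 r 1 * Θ ω) E.P ∧
        Integrable (fun ω ↦ magicWeight t ^ towerCount (E.X δ ω) 0 r 1 * Θ₂ ω) E.P ∧
        ∫ ω, magicWeight t ^ towerCount (E.X δ ω) 0 r 1 * Θ ω ∂E.P ≤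
          (C - t * meanTower E δ r) * E.towerMoment (magicWeight t) δ r ∧
        ∫ ω, magicWeight t ^ towerCount (E.X δ ω) 0 r 1 * Θ₂ ω ∂E.P ≤
          C * E.towerMoment (magicWeight t) δ r) := by
  intro E hE hK h2 t ht
  obtain ⟨C₁, r₁, hr₁, h₁⟩ := hK t ht
  obtain ⟨C₂, r₂, hr₂, h₂'⟩ := h2 t ht
  have htabs : |t| < π / 6 := abs_lt.2 ht
  have hw0 : 0 ≤ magicWeight t := (magicWeight_nonneg_of_mem_cone ht).1
  refine ⟨2 * |t| * |C₁| + t ^ 2 * |C₁| + |C₂|, min (min r₁ r₂) 1,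
    lt_min (lt_min hr₁ hr₂) one_pos, fun r hr ↦ ?_⟩
  have hr0 : 0 < r := hr.1
  have hr1 : r ≤ 1 := (hr.2.trans_le (min_le_right _ _)).le
  filter_upwards [h₁ r ⟨hr0, hr.2.trans_le ((min_le_left _ _).trans (min_le_left _ _))⟩,
    h₂' r ⟨hr0, hr.2.trans_le ((min_le_left _ _).trans (min_le_right _ _))⟩,
    self_mem_nhdsWithin] with δ hKδ h2δ hδ
  rw [Set.mem_Ioi] at hδ
  obtain ⟨hKP, hKQ⟩ := hKδ
  intro Θ Θ₂ hΘ hΘ₂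
  obtain rfl : Θ = fun ω ↦ ∑ᶠ u ∈ (E.X δ ω).loops \ {u ∈ (E.X δ ω).loops |
      Metric.closedBall (0 : ℂ) r ⊆ {z | u.wind z ≠ 0} ∧ u.range ⊆ Metric.ball (0 : ℂ) 1},
      u.nestingPhase (coneCloud t r).density := funext hΘ
  obtain rfl : Θ₂ = fun ω ↦ ∑ᶠ u ∈ (E.X δ ω).loops \ {u ∈ (E.X δ ω).loops |
      Metric.closedBall (0 : ℂ) r ⊆ {z | u.wind z ≠ 0} ∧ u.range ⊆ Metric.ball (0 : ℂ) 1},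
      u.nestingPhase (coneCloud t r).density ^ 2 := funext hΘ₂
  -- abbreviations: weight, tilted moment, collar statistic, boundary statistics
  set w := magicWeight t with hw
  have hM : 0 < E.towerMoment w δ r := UVLinear.towerMoment_pos E hE htabs hδ r
  set M := E.towerMoment w δ r with hMdef
  set θ : UnbasedLoop ℂ → ℝ := fun u ↦ u.nestingPhase (coneCloud t r).density with hθ
  have habs : ∀ u, |θ u| ≤ |t| := fun u ↦
    ConeTilt.abs_cone_nestingPhase_le (𝔠 := coneCloud t r) rfl hr0 u
  have hsupp : ∀ u : UnbasedLoop ℂ, u.nestingPhase (coneCloud t r).density = 0 → θ u = 0 :=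
    fun _ h ↦ h
  have habs2 : ∀ u, |θ u ^ 2| ≤ t ^ 2 := fun u ↦ by
    rw [abs_pow, ← sq_abs t]
    exact pow_le_pow_left₀ (abs_nonneg _) (habs u) 2
  have hsupp2 : ∀ u : UnbasedLoop ℂ, u.nestingPhase (coneCloud t r).density = 0 → θ u ^ 2 = 0 :=
    fun _ h ↦ by simp only [hθ, h]; ring
  set DB : UnbasedLoop ℂ → Prop := fun u ↦
    ¬ Disjoint u.range (closedBall (0 : ℂ) (1 + 2 * δ) \ ball 0 (r - 2 * δ)) ∧
      ¬ (closedBall (0 : ℂ) r ⊆ {z | u.wind z ≠ 0} ∧ u.range ⊆ ball (0 : ℂ) 1) with hDB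
  set Kf : E.Ω → ℝ := fun ω ↦
    (∑ᶠ u ∈ {u ∈ (E.X δ ω).loops | (u.range ∩ closedBall (0 : ℂ) r).Nonempty ∧
        ¬ u.range ⊆ ball (0 : ℂ) (r - 2 * δ)}, ∫ z in {z | u.wind z ≠ 0}, discDensity 0 r z) +
      ({u ∈ (E.X δ ω).loops | closedBall (0 : ℂ) r ⊆ {z | u.wind z ≠ 0} ∧
        ¬ u.range ⊆ ball (0 : ℂ) 1 ∧
        (u.range ∩ closedBall (0 : ℂ) (1 + 2 * δ)).Nonempty}.ncard : ℝ) +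
      ∑ᶠ u ∈ {u ∈ (E.X δ ω).loops | (u.range ∩ closedBall (0 : ℂ) (1 + 2 * δ)).Nonempty ∧
        ¬ u.range ⊆ ball (0 : ℂ) 1}, ∫ z in {z | u.wind z ≠ 0}, annulusDensity 0 1 2 z with hKf
  have hiK : Integrable Kf E.P := TiltTransfer.integrable_collar E hE hδ hr0 hr1
  have hiwK : Integrable (fun ω ↦ w ^ towerCount (E.X δ ω) 0 r 1 * Kf ω) E.P :=
    TiltTransfer.integrable_towerWeight_mul_collar E hE hδ w hr0 hr1
  have hKP' : ∫ ω, Kf ω ∂E.P ≤ C₁ := hKP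
  have hKQ' : ∫ ω, w ^ towerCount (E.X δ ω) 0 r 1 * Kf ω ∂E.P ≤ C₁ * M := hKQ
  have hC₁ : C₁ ≤ |C₁| := le_abs_self _
  have hC₂ : C₂ ≤ |C₂| := le_abs_self _
  refine ⟨FirstMoment.integrable_towerWeight_mul_uvPhase E hE hδ _ t hr0 hr1,
    FirstMoment.integrable_towerWeight_mul_uvPhaseSq E hE hδ _ t hr0 hr1, ?_, ?_⟩
  · -- the first bound: split, exact untilted identity, `|Θ_B| ≤ |t| K`
    set ΘB : E.Ω → ℝ := fun ω ↦ ∑ᶠ u ∈ {u ∈ (E.X δ ω).loops | DB u}, θ u with hΘB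
    have hBabs : ∀ ω, |ΘB ω| ≤ |t| * Kf ω := fun ω ↦
      abs_uvPhaseBd_le_collar_latticeEnsembles E hE hδ ω t hr0 hr1
    have hiB : Integrable ΘB E.P :=
      TiltTransfer.integrable_finsum_sep E hE hδ t hr0 hr1 DB θ (abs_nonneg t) habs hsupp
    have hiwB : Integrable (fun ω ↦ w ^ towerCount (E.X δ ω) 0 r 1 * ΘB ω) E.P :=
      TiltTransfer.integrable_towerWeight_mul_finsum_sep E hE hδ w t hr0 hr1 DB θ (abs_nonneg t)
        habs hsupp
    have hA : -∫ ω, ΘB ω ∂E.P ≤ |t| * C₁ := by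
      have h : -∫ ω, ΘB ω ∂E.P ≤ ∫ ω, |t| * Kf ω ∂E.P := by
        rw [← integral_neg]
        exact integral_mono hiB.neg (hiK.const_mul _) fun ω ↦ (neg_le_abs _).trans (hBabs ω)
      rw [integral_const_mul] at h
      exact h.trans (mul_le_mul_of_nonneg_left hKP' (abs_nonneg t))
    have hB : ∫ ω, w ^ towerCount (E.X δ ω) 0 r 1 * ΘB ω ∂E.P ≤ |t| * (C₁ * M) := by
      have h : ∫ ω, w ^ towerCount (E.X δ ω) 0 r 1 * ΘB ω ∂E.P ≤
          ∫ ω, |t| * (w ^ towerCount (E.X δ ω) 0 r 1 * Kf ω) ∂E.P :=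
        integral_mono hiwB (hiwK.const_mul _) fun ω ↦ by
          have hwN : 0 ≤ w ^ towerCount (E.X δ ω) 0 r 1 := pow_nonneg hw0 _
          calc w ^ towerCount (E.X δ ω) 0 r 1 * ΘB ω
              ≤ w ^ towerCount (E.X δ ω) 0 r 1 * (|t| * Kf ω) :=
                mul_le_mul_of_nonneg_left ((le_abs_self _).trans (hBabs ω)) hwN
            _ = |t| * (w ^ towerCount (E.X δ ω) 0 r 1 * Kf ω) := by ring
      rw [integral_const_mul] at h
      exact h.trans (mul_le_mul_of_nonneg_left hKQ' (abs_nonneg t))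
    show ∫ ω, w ^ towerCount (E.X δ ω) 0 r 1 *
        ∑ᶠ u ∈ (E.X δ ω).loops \ {u ∈ (E.X δ ω).loops |
          closedBall (0 : ℂ) r ⊆ {z | u.wind z ≠ 0} ∧ u.range ⊆ ball (0 : ℂ) 1}, θ u ∂E.P ≤ _
    rw [integral_towerWeight_mul_uvPhase_eq_split E hE hδ w t hr0 hr1,
      integral_uvPhase_latticeEnsembles E hE hδ t hr0 hr1]
    change M * (-t * meanTower E δ r - ∫ ω, ΘB ω ∂E.P) +
        ∫ ω, w ^ towerCount (E.X δ ω) 0 r 1 * ΘB ω ∂E.P ≤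
      (2 * |t| * |C₁| + t ^ 2 * |C₁| + |C₂| - t * meanTower E δ r) * M
    have h1 : M * -∫ ω, ΘB ω ∂E.P ≤ M * (|t| * C₁) := mul_le_mul_of_nonneg_left hA hM.le
    have h3 : |t| * C₁ * M ≤ |t| * |C₁| * M :=
      mul_le_mul_of_nonneg_right (mul_le_mul_of_nonneg_left hC₁ (abs_nonneg t)) hM.le
    have h4 : 0 ≤ t ^ 2 * |C₁| * M := by positivity
    have h5 : 0 ≤ |C₂| * M := by positivity
    nlinarith [h1, hB, h3, h4, h5]
  · -- the second bound: split for `θ²`, `0 ≤ Θ₂,B ≤ t² K`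
    set Θ₂B : E.Ω → ℝ := fun ω ↦ ∑ᶠ u ∈ {u ∈ (E.X δ ω).loops | DB u}, θ u ^ 2 with hΘ₂B
    have hB2 : ∀ ω, Θ₂B ω ≤ t ^ 2 * Kf ω := fun ω ↦
      uvPhaseSqBd_le_collar_latticeEnsembles E hE hδ ω t hr0 hr1
    have hB2nn : ∀ ω, 0 ≤ Θ₂B ω := fun ω ↦ finsum_nonneg fun u ↦ finsum_nonneg fun _ ↦ sq_nonneg _
    have hiwB2 : Integrable (fun ω ↦ w ^ towerCount (E.X δ ω) 0 r 1 * Θ₂B ω) E.P :=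
      TiltTransfer.integrable_towerWeight_mul_finsum_sep E hE hδ w t hr0 hr1 DB _ (sq_nonneg t)
        habs2 hsupp2
    have hD : 0 ≤ ∫ ω, Θ₂B ω ∂E.P := integral_nonneg hB2nn
    have hE2 : ∫ ω, w ^ towerCount (E.X δ ω) 0 r 1 * Θ₂B ω ∂E.P ≤ t ^ 2 * (C₁ * M) := by
      have h : ∫ ω, w ^ towerCount (E.X δ ω) 0 r 1 * Θ₂B ω ∂E.P ≤
          ∫ ω, t ^ 2 * (w ^ towerCount (E.X δ ω) 0 r 1 * Kf ω) ∂E.P :=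
        integral_mono hiwB2 (hiwK.const_mul _) fun ω ↦ by
          have hwN : 0 ≤ w ^ towerCount (E.X δ ω) 0 r 1 := pow_nonneg hw0 _
          calc w ^ towerCount (E.X δ ω) 0 r 1 * Θ₂B ω
              ≤ w ^ towerCount (E.X δ ω) 0 r 1 * (t ^ 2 * Kf ω) :=
                mul_le_mul_of_nonneg_left (hB2 ω) hwN
            _ = t ^ 2 * (w ^ towerCount (E.X δ ω) 0 r 1 * Kf ω) := by ring
      rw [integral_const_mul] at h
      exact h.trans (mul_le_mul_of_nonneg_left hKQ' (sq_nonneg t))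
    have h2δ' : ∫ ω, ∑ᶠ u ∈ (E.X δ ω).loops \ {u ∈ (E.X δ ω).loops |
        closedBall (0 : ℂ) r ⊆ {z | u.wind z ≠ 0} ∧ u.range ⊆ ball (0 : ℂ) 1}, θ u ^ 2 ∂E.P ≤ C₂ :=
      h2δ
    show ∫ ω, w ^ towerCount (E.X δ ω) 0 r 1 *
        ∑ᶠ u ∈ (E.X δ ω).loops \ {u ∈ (E.X δ ω).loops |
          closedBall (0 : ℂ) r ⊆ {z | u.wind z ≠ 0} ∧ u.range ⊆ ball (0 : ℂ) 1}, θ u ^ 2 ∂E.P ≤ _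
    rw [TiltTransfer.integral_towerWeight_mul_finsum_sdiff_tower_eq_split E hE hδ w t hr0 hr1
      (fun u ↦ θ u ^ 2) (sq_nonneg t) habs2 hsupp2]
    change M * ((∫ ω, ∑ᶠ u ∈ (E.X δ ω).loops \ {u ∈ (E.X δ ω).loops |
        closedBall (0 : ℂ) r ⊆ {z | u.wind z ≠ 0} ∧ u.range ⊆ ball (0 : ℂ) 1}, θ u ^ 2 ∂E.P) -
          ∫ ω, Θ₂B ω ∂E.P) +
        ∫ ω, w ^ towerCount (E.X δ ω) 0 r 1 * Θ₂B ω ∂E.P ≤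
      (2 * |t| * |C₁| + t ^ 2 * |C₁| + |C₂|) * M
    have h1 : M * ((∫ ω, ∑ᶠ u ∈ (E.X δ ω).loops \ {u ∈ (E.X δ ω).loops |
        closedBall (0 : ℂ) r ⊆ {z | u.wind z ≠ 0} ∧ u.range ⊆ ball (0 : ℂ) 1}, θ u ^ 2 ∂E.P) -
          ∫ ω, Θ₂B ω ∂E.P) ≤ M * |C₂| :=
      mul_le_mul_of_nonneg_left (by linarith) hM.le
    have h3 : t ^ 2 * C₁ * M ≤ t ^ 2 * |C₁| * M :=
      mul_le_mul_of_nonneg_right (mul_le_mul_of_nonneg_left hC₁ (sq_nonneg t)) hM.le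
    have h4 : 0 ≤ 2 * |t| * |C₁| * M := by positivity
    nlinarith [h1, hE2, h3, h4]

/-- **The integrability conjunct of hypothesis (U) holds outright**: `w^{N_0(r,1)} · e^{−√3 Θ}` is
integrable on both lattices for every real `w`, mesh `δ > 0`, charge `t`, `0 < r ≤ 1` (bounded
measurable integrand: `|Θ| ≤ B(δ)`, `N_0(r,1) ≤ N(δ)`; probability law). -/
theorem integrable_towerWeight_mul_exp_uvPhase : ∀ E ∈ latticeEnsembles, ∀ {δ : ℝ}, 0 < δ →
    ∀ (w t : ℝ) {r : ℝ}, 0 < r → r ≤ 1 →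
    Integrable (fun ω ↦ w ^ towerCount (E.X δ ω) 0 r 1 *
      Real.exp (-(Real.sqrt 3 * ∑ᶠ u ∈ (E.X δ ω).loops \ {u ∈ (E.X δ ω).loops |
        Metric.closedBall (0 : ℂ) r ⊆ {z | u.wind z ≠ 0} ∧ u.range ⊆ Metric.ball (0 : ℂ) 1},
        u.nestingPhase (coneCloud t r).density))) E.P := by
  intro E hE δ hδ w t r hr hr1
  haveI := isProbabilityMeasure_of_mem hE
  obtain ⟨B, hB⟩ := FirstMoment.exists_abs_finsum_sdiff_le E hE hδ t hr hr1
    (fun u ↦ u.nestingPhase (coneCloud t r).density) (abs_nonneg t)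
    (fun u ↦ ConeTilt.abs_cone_nestingPhase_le (𝔠 := coneCloud t r) rfl hr u) (fun _ h ↦ h)
  obtain ⟨N, hN⟩ := ConeTilt.exists_towerCount_le E hE hδ 0 r 1
  have hm : Measurable fun ω ↦ w ^ towerCount (E.X δ ω) 0 r 1 *
      Real.exp (-(Real.sqrt 3 * ∑ᶠ u ∈ (E.X δ ω).loops \ {u ∈ (E.X δ ω).loops |
        Metric.closedBall (0 : ℂ) r ⊆ {z | u.wind z ≠ 0} ∧ u.range ⊆ Metric.ball (0 : ℂ) 1},
        u.nestingPhase (coneCloud t r).density)) :=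
    ((measurable_towerCount E hE δ 0 r 1).const_pow w).mul
      (Real.measurable_exp.comp
        ((FirstMoment.measurable_finsum_loops_sdiff_sep E hE δ _ _).const_mul _).neg)
  refine Integrable.of_bound hm.aestronglyMeasurable (max 1 |w| ^ N * Real.exp (Real.sqrt 3 * B))
    (Eventually.of_forall fun ω ↦ ?_)
  rw [Real.norm_eq_abs, abs_mul, abs_pow, Real.abs_exp]
  refine mul_le_mul ((pow_le_pow_left₀ (abs_nonneg w) (le_max_right 1 |w|) _).trans
    (pow_le_pow_right₀ (le_max_left 1 |w|) (hN ω))) (Real.exp_le_exp.2 ?_) (Real.exp_pos _).le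
    (by positivity)
  rw [neg_mul_eq_mul_neg]
  exact mul_le_mul_of_nonneg_left ((neg_le_abs _).trans (hB ω _)) (Real.sqrt_nonneg 3)

/-- **`UVDecoupling E` from collar first moments and the tilted exponential moment** (both
lattices): (HK) and (H2) of `lowerInput_of_collar_bounds` give hypothesis (L) of
`uvDecoupling_of_tilted_moments`, and hypothesis (U) is needed only as the inequality
`E_δ[w^N e^{−√3 Θ}] ≤ C e^{√3 t E_δ N} E_δ[w^N]` (its integrability conjunct holds outright,
`integrable_towerWeight_mul_exp_uvPhase`).  So stub R1' `stub_uvDecoupling` is EXACTLY these three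
RSW estimates away, on each of `zEns`, `tEns`. -/
theorem uvDecoupling_of_collar_bounds : ∀ E ∈ latticeEnsembles,
    (∀ t ∈ Set.Ioo (-(π / 6)) (π / 6), ∃ C r₀ : ℝ, 0 < r₀ ∧ ∀ r ∈ Set.Ioo (0 : ℝ) r₀,
      ∀ᶠ δ in 𝓝[>] (0 : ℝ),
        ∫ ω, ((∑ᶠ u ∈ {u ∈ (E.X δ ω).loops | (u.range ∩ Metric.closedBall (0 : ℂ) r).Nonempty ∧
              ¬ u.range ⊆ Metric.ball (0 : ℂ) (r - 2 * δ)},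
              ∫ z in {z | u.wind z ≠ 0}, discDensity 0 r z) +
            ({u ∈ (E.X δ ω).loops | Metric.closedBall (0 : ℂ) r ⊆ {z | u.wind z ≠ 0} ∧
              ¬ u.range ⊆ Metric.ball (0 : ℂ) 1 ∧
              (u.range ∩ Metric.closedBall (0 : ℂ) (1 + 2 * δ)).Nonempty}.ncard : ℝ) +
            ∑ᶠ u ∈ {u ∈ (E.X δ ω).loops |
              (u.range ∩ Metric.closedBall (0 : ℂ) (1 + 2 * δ)).Nonempty ∧
                ¬ u.range ⊆ Metric.ball (0 : ℂ) 1},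
              ∫ z in {z | u.wind z ≠ 0}, annulusDensity 0 1 2 z) ∂E.P ≤ C ∧
        ∫ ω, magicWeight t ^ towerCount (E.X δ ω) 0 r 1 *
            ((∑ᶠ u ∈ {u ∈ (E.X δ ω).loops | (u.range ∩ Metric.closedBall (0 : ℂ) r).Nonempty ∧
                ¬ u.range ⊆ Metric.ball (0 : ℂ) (r - 2 * δ)},
                ∫ z in {z | u.wind z ≠ 0}, discDensity 0 r z) +
              ({u ∈ (E.X δ ω).loops | Metric.closedBall (0 : ℂ) r ⊆ {z | u.wind z ≠ 0} ∧
                ¬ u.range ⊆ Metric.ball (0 : ℂ) 1 ∧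
                (u.range ∩ Metric.closedBall (0 : ℂ) (1 + 2 * δ)).Nonempty}.ncard : ℝ) +
              ∑ᶠ u ∈ {u ∈ (E.X δ ω).loops |
                (u.range ∩ Metric.closedBall (0 : ℂ) (1 + 2 * δ)).Nonempty ∧
                  ¬ u.range ⊆ Metric.ball (0 : ℂ) 1},
                ∫ z in {z | u.wind z ≠ 0}, annulusDensity 0 1 2 z) ∂E.P ≤
          C * E.towerMoment (magicWeight t) δ r) →
    (∀ t ∈ Set.Ioo (-(π / 6)) (π / 6), ∃ C r₀ : ℝ, 0 < r₀ ∧ ∀ r ∈ Set.Ioo (0 : ℝ) r₀,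
      ∀ᶠ δ in 𝓝[>] (0 : ℝ),
        ∫ ω, ∑ᶠ u ∈ (E.X δ ω).loops \ {u ∈ (E.X δ ω).loops |
            Metric.closedBall (0 : ℂ) r ⊆ {z | u.wind z ≠ 0} ∧ u.range ⊆ Metric.ball (0 : ℂ) 1},
            u.nestingPhase (coneCloud t r).density ^ 2 ∂E.P ≤ C) →
    (∀ t ∈ Set.Ioo (-(π / 6)) (π / 6), ∃ C r₀ : ℝ, 0 < r₀ ∧ ∀ r ∈ Set.Ioo (0 : ℝ) r₀,
      ∀ᶠ δ in 𝓝[>] (0 : ℝ),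
        ∫ ω, magicWeight t ^ towerCount (E.X δ ω) 0 r 1 *
            Real.exp (-(Real.sqrt 3 * ∑ᶠ u ∈ (E.X δ ω).loops \ {u ∈ (E.X δ ω).loops |
              Metric.closedBall (0 : ℂ) r ⊆ {z | u.wind z ≠ 0} ∧ u.range ⊆ Metric.ball (0 : ℂ) 1},
              u.nestingPhase (coneCloud t r).density)) ∂E.P ≤
          C * Real.exp (Real.sqrt 3 * t * meanTower E δ r) * E.towerMoment (magicWeight t) δ r) →
    UVDecoupling E := by
  intro E hE hK h2 hU
  refine uvDecoupling_of_tilted_moments E hE (lowerInput_of_collar_bounds E hE hK h2) fun t ht ↦ ?_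
  obtain ⟨C, r₀, hr₀, h⟩ := hU t ht
  refine ⟨C, min r₀ 1, lt_min hr₀ one_pos, fun r hr ↦ ?_⟩
  have hr1 : r ≤ 1 := (hr.2.trans_le (min_le_right _ _)).le
  filter_upwards [h r ⟨hr.1, hr.2.trans_le (min_le_left _ _)⟩, self_mem_nhdsWithin] with δ hδU hδ
  intro Θ hΘ
  obtain rfl : Θ = fun ω ↦ ∑ᶠ u ∈ (E.X δ ω).loops \ {u ∈ (E.X δ ω).loops |
      Metric.closedBall (0 : ℂ) r ⊆ {z | u.wind z ≠ 0} ∧ u.range ⊆ Metric.ball (0 : ℂ) 1},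
      u.nestingPhase (coneCloud t r).density := funext hΘ
  exact ⟨integrable_towerWeight_mul_exp_uvPhase E hE hδ _ t hr.1 hr1, hδU⟩

end Summit.CriticalPhenomena.CardyFormulaZ2.Cruxes.NestingRigidity.RingCloudTomography

end
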